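import Mathlib
import Literature.Analysis.FluidPDE.StretchedLayerNS
import HarnessLib

/-!
# Stub `stub_potentialFlow`: entire periodic complex velocities are steady stretched-layer flows

Crux `stmt-AnomalousDissipation-3009` (`MarginalStabilityChain.StretchedVortexRows`), line
`potential-flow-essential-singularity`, registered stub `stub_potentialFlow` of the lead skeleton.

**Statement.** Let `Φ : ℂ → ℂ` be entire and `L`-periodic, with the pointwise far field
`Φ(x + iy) → 1/2` as `y → +∞` and `Φ(x + iy) → -1/2` as `y → -∞` for every real `x`. With
`z = x + iy`, `u = Re Φ(z)`, `v = -Im Φ(z)` and the Bernoulli pressure `p = -(u² + v²)/2 + y v`,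
the triple `(u, v, p)` is a steady member of the stretched two-dimensional Navier–Stokes class
`IsSteadyStretchedLayerNSSolution ν 1 1 L` for EVERY viscosity `ν`; moreover `∂ₓu = Re Φ'(z)` and
`∂ₓv = -Im Φ'(z)`.

**Proof (calculus bookkeeping).**
* Slice dictionary (Cauchy–Riemann). Along `s ↦ s + iy` the curve `s ↦ Ψ(s + iy)` has derivative
  `Ψ'(z)`; along `s ↦ x + is` it has derivative `Ψ'(z)·i` (`HasDerivAt.comp_ofReal`). Taking real
  and imaginary parts (`Complex.reCLM`, `Complex.imCLM`):
  `∂ₓ Re Ψ = Re Ψ'`, `∂ₓ Im Ψ = Im Ψ'`, `∂_y Re Ψ = -Im Ψ'`, `∂_y Im Ψ = Re Ψ'`.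
* Applied to `Φ` and to `Φ'` (entire again, `Differentiable.deriv`): `∂ₓu = Re Φ'`,
  `∂_yu = -Im Φ'`, `∂ₓv = -Im Φ'`, `∂_yv = -Re Φ'`; `∂ₓ∂ₓu = Re Φ''`, `∂_y∂_yu = -Re Φ''`,
  `∂ₓ∂ₓv = -Im Φ''`, `∂_y∂_yv = Im Φ''`. Hence `Δu = Δv = 0`, `∂ₓu + ∂_yv = 0`, `∂_yu = ∂ₓv`.
* `∂ₓp = -(u∂ₓu + v∂ₓv) + y∂ₓv`, `∂_yp = -(u∂_yu + v∂_yv) + v + y∂_yv` (product rule on the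
  slices), after which both momentum equations
  `u∂ₓu + (v - y)∂_yu = -∂ₓp + νΔu`, `u∂ₓv + (v - y)∂_yv - v = -∂_yp + νΔv` are ring identities.
* Regularity: `Φ` is real-`C^∞` (`Differentiable.contDiff`, `ContDiff.restrict_scalars`), composed
  with the real-linear map `(x, y) ↦ x + iy` and with `re`, `im`; `p` is a polynomial in `u, v, y`.
* Periodicity from `Φ(z + L) = Φ(z)` (`(x + L) + iy = (x + iy) + L`); the far field by continuity
  of `re`, `im` (`Re(±1/2) = ±1/2`, `Im(±1/2) = 0`).

Sources: folklore (irrotational flows solve the Navier–Stokes equations with the Bernoulli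
pressure for every viscosity); the class is that of Majda–Bertozzi 2002, §1.4 (strained shear
layers), see `Literature/Analysis/FluidPDE/StretchedLayerNS.lean`.
-/

-- summit and problem are both named `AnomalousDissipation`, so every name repeats the component
set_option linter.dupNamespace false

noncomputable section

open scoped Topology ENNReal Real
open Filter Set Function MeasureTheory Complex

namespace Summit.AnomalousDissipation.AnomalousDissipation.Theorems
namespace MarginalStabilityChainStretchedVortexRows
namespace PotentialFlow

open Literature.Analysis.FluidPDE Literature.Analysis.FluidPDE.StretchedLayer

/-! ### Real and imaginary parts of differentiable curves `ℝ → ℂ` -/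

/-- The real part of a differentiable curve `ℝ → ℂ` has derivative the real part of the
derivative. [folklore] -/
theorem potentialFlow_hasDerivAt_re {e : ℝ → ℂ} {e' : ℂ} {s : ℝ} (h : HasDerivAt e e' s) :
    HasDerivAt (fun t => (e t).re) e'.re s := by
  simpa [Function.comp_def] using Complex.reCLM.hasFDerivAt.comp_hasDerivAt s h

/-- The imaginary part of a differentiable curve `ℝ → ℂ` has derivative the imaginary part of the
derivative. [folklore] -/
theorem potentialFlow_hasDerivAt_im {e : ℝ → ℂ} {e' : ℂ} {s : ℝ} (h : HasDerivAt e e' s) :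
    HasDerivAt (fun t => (e t).im) e'.im s := by
  simpa [Function.comp_def] using Complex.imCLM.hasFDerivAt.comp_hasDerivAt s h

/-- `d/ds (f s)² = 2 f(s) f'(s)` for a real differentiable `f`. [folklore] -/
theorem potentialFlow_hasDerivAt_sq {f : ℝ → ℝ} {f' s : ℝ} (h : HasDerivAt f f' s) :
    HasDerivAt (fun t => f t ^ 2) (2 * f s * f') s := by
  have h2 := h.fun_mul h
  simp only [← sq] at h2
  exact h2.congr_deriv (by ring)

/-! ### The slice dictionary of an entire function along horizontal and vertical lines -/

variable {Ψ Φ : ℂ → ℂ}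

/-- Horizontal slice through `z = x + iy` of an entire `Ψ`: the curve `s ↦ Ψ(s + iy)` has
derivative `Ψ'(z)` at `s = x`. [folklore] -/
theorem potentialFlow_hasDerivAt_sliceX (hΨ : Differentiable ℂ Ψ) (x y : ℝ) :
    HasDerivAt (fun s : ℝ => Ψ ((s : ℂ) + (y : ℂ) * I)) (deriv Ψ ((x : ℂ) + (y : ℂ) * I)) x := by
  have h : HasDerivAt (fun w : ℂ => Ψ (w + (y : ℂ) * I)) (deriv Ψ ((x : ℂ) + (y : ℂ) * I))
      (x : ℂ) :=
    HasDerivAt.comp_add_const (x : ℂ) ((y : ℂ) * I) (hΨ _).hasDerivAt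
  exact h.comp_ofReal

/-- Vertical slice through `z = x + iy` of an entire `Ψ`: the curve `s ↦ Ψ(x + is)` has
derivative `Ψ'(z)·i` at `s = y`. [folklore] -/
theorem potentialFlow_hasDerivAt_sliceY (hΨ : Differentiable ℂ Ψ) (x y : ℝ) :
    HasDerivAt (fun s : ℝ => Ψ ((x : ℂ) + (s : ℂ) * I)) (deriv Ψ ((x : ℂ) + (y : ℂ) * I) * I)
      y := by
  have hin : HasDerivAt (fun w : ℂ => (x : ℂ) + w * I) I (y : ℂ) :=
    (hasDerivAt_mul_const I).const_add (x : ℂ)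
  have h : HasDerivAt (fun w : ℂ => Ψ ((x : ℂ) + w * I)) (deriv Ψ ((x : ℂ) + (y : ℂ) * I) * I)
      (y : ℂ) :=
    (hΨ _).hasDerivAt.comp (y : ℂ) hin
  exact h.comp_ofReal

/-- `∂ₓ Re Ψ = Re Ψ'` (slice form). [folklore] -/
theorem potentialFlow_hasDerivAt_sliceX_re (hΨ : Differentiable ℂ Ψ) (x y : ℝ) :
    HasDerivAt (fun s : ℝ => (Ψ ((s : ℂ) + (y : ℂ) * I)).re)
      (deriv Ψ ((x : ℂ) + (y : ℂ) * I)).re x :=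
  potentialFlow_hasDerivAt_re (potentialFlow_hasDerivAt_sliceX hΨ x y)

/-- `∂ₓ Im Ψ = Im Ψ'` (slice form). [folklore] -/
theorem potentialFlow_hasDerivAt_sliceX_im (hΨ : Differentiable ℂ Ψ) (x y : ℝ) :
    HasDerivAt (fun s : ℝ => (Ψ ((s : ℂ) + (y : ℂ) * I)).im)
      (deriv Ψ ((x : ℂ) + (y : ℂ) * I)).im x :=
  potentialFlow_hasDerivAt_im (potentialFlow_hasDerivAt_sliceX hΨ x y)

/-- `∂_y Re Ψ = -Im Ψ'` (slice form; `Re(Ψ' i) = -Im Ψ'`). [folklore] -/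
theorem potentialFlow_hasDerivAt_sliceY_re (hΨ : Differentiable ℂ Ψ) (x y : ℝ) :
    HasDerivAt (fun s : ℝ => (Ψ ((x : ℂ) + (s : ℂ) * I)).re)
      (-(deriv Ψ ((x : ℂ) + (y : ℂ) * I)).im) y := by
  simpa using potentialFlow_hasDerivAt_re (potentialFlow_hasDerivAt_sliceY hΨ x y)

/-- `∂_y Im Ψ = Re Ψ'` (slice form; `Im(Ψ' i) = Re Ψ'`). [folklore] -/
theorem potentialFlow_hasDerivAt_sliceY_im (hΨ : Differentiable ℂ Ψ) (x y : ℝ) :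
    HasDerivAt (fun s : ℝ => (Ψ ((x : ℂ) + (s : ℂ) * I)).im)
      (deriv Ψ ((x : ℂ) + (y : ℂ) * I)).re y := by
  simpa using potentialFlow_hasDerivAt_im (potentialFlow_hasDerivAt_sliceY hΨ x y)

/-! ### First slice derivatives of `u = Re Φ(x + iy)` and `v = -Im Φ(x + iy)` -/

/-- `∂ₓu = Re Φ'`. [folklore] -/
theorem potentialFlow_dX_u (hΦ : Differentiable ℂ Φ) (x y : ℝ) :
    dX (fun x y => (Φ ((x : ℂ) + (y : ℂ) * I)).re) x y = (deriv Φ ((x : ℂ) + (y : ℂ) * I)).re :=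
  (potentialFlow_hasDerivAt_sliceX_re hΦ x y).deriv

/-- `∂_yu = -Im Φ'`. [folklore] -/
theorem potentialFlow_dY_u (hΦ : Differentiable ℂ Φ) (x y : ℝ) :
    dY (fun x y => (Φ ((x : ℂ) + (y : ℂ) * I)).re) x y = -(deriv Φ ((x : ℂ) + (y : ℂ) * I)).im :=
  (potentialFlow_hasDerivAt_sliceY_re hΦ x y).deriv

/-- `∂ₓv = -Im Φ'`. [folklore] -/
theorem potentialFlow_dX_v (hΦ : Differentiable ℂ Φ) (x y : ℝ) :
    dX (fun x y => -(Φ ((x : ℂ) + (y : ℂ) * I)).im) x y = -(deriv Φ ((x : ℂ) + (y : ℂ) * I)).im :=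
  (potentialFlow_hasDerivAt_sliceX_im hΦ x y).fun_neg.deriv

/-- `∂_yv = -Re Φ'`. [folklore] -/
theorem potentialFlow_dY_v (hΦ : Differentiable ℂ Φ) (x y : ℝ) :
    dY (fun x y => -(Φ ((x : ℂ) + (y : ℂ) * I)).im) x y = -(deriv Φ ((x : ℂ) + (y : ℂ) * I)).re :=
  (potentialFlow_hasDerivAt_sliceY_im hΦ x y).fun_neg.deriv

/-- `∂_y(-Re Ψ) = Im Ψ'` (used for `∂_y∂_yv`). [folklore] -/
theorem potentialFlow_dY_negRe (hΨ : Differentiable ℂ Ψ) (x y : ℝ) :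
    dY (fun x y => -(Ψ ((x : ℂ) + (y : ℂ) * I)).re) x y = (deriv Ψ ((x : ℂ) + (y : ℂ) * I)).im := by
  have h := (potentialFlow_hasDerivAt_sliceY_re hΨ x y).fun_neg.deriv
  rw [neg_neg] at h
  exact h

/-- `∂ₓu = Re Φ'` as an identity of plane fields. [folklore] -/
theorem potentialFlow_dX_u_eq (hΦ : Differentiable ℂ Φ) :
    dX (fun x y => (Φ ((x : ℂ) + (y : ℂ) * I)).re) =
      fun x y : ℝ => (deriv Φ ((x : ℂ) + (y : ℂ) * I)).re :=
  funext fun x => funext fun y => potentialFlow_dX_u hΦ x y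

/-- `∂_yu = -Im Φ'` as an identity of plane fields. [folklore] -/
theorem potentialFlow_dY_u_eq (hΦ : Differentiable ℂ Φ) :
    dY (fun x y => (Φ ((x : ℂ) + (y : ℂ) * I)).re) =
      fun x y : ℝ => -(deriv Φ ((x : ℂ) + (y : ℂ) * I)).im :=
  funext fun x => funext fun y => potentialFlow_dY_u hΦ x y

/-- `∂ₓv = -Im Φ'` as an identity of plane fields. [folklore] -/
theorem potentialFlow_dX_v_eq (hΦ : Differentiable ℂ Φ) :
    dX (fun x y => -(Φ ((x : ℂ) + (y : ℂ) * I)).im) =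
      fun x y : ℝ => -(deriv Φ ((x : ℂ) + (y : ℂ) * I)).im :=
  funext fun x => funext fun y => potentialFlow_dX_v hΦ x y

/-- `∂_yv = -Re Φ'` as an identity of plane fields. [folklore] -/
theorem potentialFlow_dY_v_eq (hΦ : Differentiable ℂ Φ) :
    dY (fun x y => -(Φ ((x : ℂ) + (y : ℂ) * I)).im) =
      fun x y : ℝ => -(deriv Φ ((x : ℂ) + (y : ℂ) * I)).re :=
  funext fun x => funext fun y => potentialFlow_dY_v hΦ x y

/-! ### Second slice derivatives: `u`, `v` are harmonic -/

/-- `∂ₓ∂ₓu = Re Φ''`. [folklore] -/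
theorem potentialFlow_dXX_u (hΦ : Differentiable ℂ Φ) (x y : ℝ) :
    dX (dX (fun x y => (Φ ((x : ℂ) + (y : ℂ) * I)).re)) x y =
      (deriv (deriv Φ) ((x : ℂ) + (y : ℂ) * I)).re := by
  rw [potentialFlow_dX_u_eq hΦ]
  exact potentialFlow_dX_u hΦ.deriv x y

/-- `∂_y∂_yu = -Re Φ''`. [folklore] -/
theorem potentialFlow_dYY_u (hΦ : Differentiable ℂ Φ) (x y : ℝ) :
    dY (dY (fun x y => (Φ ((x : ℂ) + (y : ℂ) * I)).re)) x y =
      -(deriv (deriv Φ) ((x : ℂ) + (y : ℂ) * I)).re := by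
  rw [potentialFlow_dY_u_eq hΦ]
  exact potentialFlow_dY_v hΦ.deriv x y

/-- `∂ₓ∂ₓv = -Im Φ''`. [folklore] -/
theorem potentialFlow_dXX_v (hΦ : Differentiable ℂ Φ) (x y : ℝ) :
    dX (dX (fun x y => -(Φ ((x : ℂ) + (y : ℂ) * I)).im)) x y =
      -(deriv (deriv Φ) ((x : ℂ) + (y : ℂ) * I)).im := by
  rw [potentialFlow_dX_v_eq hΦ]
  exact potentialFlow_dX_v hΦ.deriv x y

/-- `∂_y∂_yv = Im Φ''`. [folklore] -/
theorem potentialFlow_dYY_v (hΦ : Differentiable ℂ Φ) (x y : ℝ) :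
    dY (dY (fun x y => -(Φ ((x : ℂ) + (y : ℂ) * I)).im)) x y =
      (deriv (deriv Φ) ((x : ℂ) + (y : ℂ) * I)).im := by
  rw [potentialFlow_dY_v_eq hΦ]
  exact potentialFlow_dY_negRe hΦ.deriv x y

/-- `Δu = 0`. [folklore] -/
theorem potentialFlow_lap_u (hΦ : Differentiable ℂ Φ) (x y : ℝ) :
    lap (fun x y => (Φ ((x : ℂ) + (y : ℂ) * I)).re) x y = 0 := by
  rw [lap_apply, potentialFlow_dXX_u hΦ, potentialFlow_dYY_u hΦ]
  ring

/-- `Δv = 0`. [folklore] -/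
theorem potentialFlow_lap_v (hΦ : Differentiable ℂ Φ) (x y : ℝ) :
    lap (fun x y => -(Φ ((x : ℂ) + (y : ℂ) * I)).im) x y = 0 := by
  rw [lap_apply, potentialFlow_dXX_v hΦ, potentialFlow_dYY_v hΦ]
  ring

/-! ### The Bernoulli pressure `p = -(u² + v²)/2 + y v` -/

/-- `∂ₓp = -(u ∂ₓu + v ∂ₓv) + y ∂ₓv`, written through `Φ`, `Φ'`. [folklore] -/
theorem potentialFlow_dX_p (hΦ : Differentiable ℂ Φ) (x y : ℝ) :
    dX (fun x y => -((Φ ((x : ℂ) + (y : ℂ) * I)).re ^ 2 + (Φ ((x : ℂ) + (y : ℂ) * I)).im ^ 2) / 2 +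
        y * (-(Φ ((x : ℂ) + (y : ℂ) * I)).im)) x y =
      -((Φ ((x : ℂ) + (y : ℂ) * I)).re * (deriv Φ ((x : ℂ) + (y : ℂ) * I)).re +
          (Φ ((x : ℂ) + (y : ℂ) * I)).im * (deriv Φ ((x : ℂ) + (y : ℂ) * I)).im) -
        y * (deriv Φ ((x : ℂ) + (y : ℂ) * I)).im := by
  have ha := potentialFlow_hasDerivAt_sliceX_re hΦ x y
  have hb := potentialFlow_hasDerivAt_sliceX_im hΦ x y
  have h := (((potentialFlow_hasDerivAt_sq ha).fun_add (potentialFlow_hasDerivAt_sq hb)).fun_neg.div_const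
    2).fun_add (hb.fun_neg.const_mul y)
  have h2 : dX (fun x y => -((Φ ((x : ℂ) + (y : ℂ) * I)).re ^ 2 +
      (Φ ((x : ℂ) + (y : ℂ) * I)).im ^ 2) / 2 + y * (-(Φ ((x : ℂ) + (y : ℂ) * I)).im)) x y = _ :=
    h.deriv
  rw [h2]
  ring

/-- `∂_yp = -(u ∂_yu + v ∂_yv) + v + y ∂_yv`, written through `Φ`, `Φ'`. [folklore] -/
theorem potentialFlow_dY_p (hΦ : Differentiable ℂ Φ) (x y : ℝ) :
    dY (fun x y => -((Φ ((x : ℂ) + (y : ℂ) * I)).re ^ 2 + (Φ ((x : ℂ) + (y : ℂ) * I)).im ^ 2) / 2 +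
        y * (-(Φ ((x : ℂ) + (y : ℂ) * I)).im)) x y =
      -((Φ ((x : ℂ) + (y : ℂ) * I)).re * (-(deriv Φ ((x : ℂ) + (y : ℂ) * I)).im) +
          (Φ ((x : ℂ) + (y : ℂ) * I)).im * (deriv Φ ((x : ℂ) + (y : ℂ) * I)).re) -
        (Φ ((x : ℂ) + (y : ℂ) * I)).im - y * (deriv Φ ((x : ℂ) + (y : ℂ) * I)).re := by
  have ha := potentialFlow_hasDerivAt_sliceY_re hΦ x y
  have hb := potentialFlow_hasDerivAt_sliceY_im hΦ x y
  have h := (((potentialFlow_hasDerivAt_sq ha).fun_add (potentialFlow_hasDerivAt_sq hb)).fun_neg.div_const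
    2).fun_add ((hasDerivAt_id' y).fun_mul hb.fun_neg)
  have h2 : dY (fun x y => -((Φ ((x : ℂ) + (y : ℂ) * I)).re ^ 2 +
      (Φ ((x : ℂ) + (y : ℂ) * I)).im ^ 2) / 2 + y * (-(Φ ((x : ℂ) + (y : ℂ) * I)).im)) x y = _ :=
    h.deriv
  rw [h2]
  ring

/-! ### Regularity, periodicity, far field -/

/-- The real-linear coordinate map `(x, y) ↦ x + iy` is smooth. [folklore] -/
theorem potentialFlow_contDiff_coord {n : WithTop ℕ∞} :
    ContDiff ℝ n (fun q : ℝ × ℝ => (q.1 : ℂ) + (q.2 : ℂ) * I) := by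
  have h1 : ContDiff ℝ n (fun q : ℝ × ℝ => (q.1 : ℂ)) := ofRealCLM.contDiff.comp contDiff_fst
  have h2 : ContDiff ℝ n (fun q : ℝ × ℝ => (q.2 : ℂ)) := ofRealCLM.contDiff.comp contDiff_snd
  exact h1.add (h2.mul contDiff_const)

/-- `(x, y) ↦ Re Φ(x + iy)` is real-`Cⁿ` for an entire `Φ`. [folklore] -/
theorem potentialFlow_contDiff_re (hΦ : Differentiable ℂ Φ) {n : WithTop ℕ∞} :
    ContDiff ℝ n (fun q : ℝ × ℝ => (Φ ((q.1 : ℂ) + (q.2 : ℂ) * I)).re) := by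
  have hΦR : ContDiff ℝ n Φ := hΦ.contDiff.restrict_scalars ℝ
  exact reCLM.contDiff.comp (hΦR.comp potentialFlow_contDiff_coord)

/-- `(x, y) ↦ Im Φ(x + iy)` is real-`Cⁿ` for an entire `Φ`. [folklore] -/
theorem potentialFlow_contDiff_im (hΦ : Differentiable ℂ Φ) {n : WithTop ℕ∞} :
    ContDiff ℝ n (fun q : ℝ × ℝ => (Φ ((q.1 : ℂ) + (q.2 : ℂ) * I)).im) := by
  have hΦR : ContDiff ℝ n Φ := hΦ.contDiff.restrict_scalars ℝ
  exact imCLM.contDiff.comp (hΦR.comp potentialFlow_contDiff_coord)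

/-- The Bernoulli pressure is real-`Cⁿ`. [folklore] -/
theorem potentialFlow_contDiff_p (hΦ : Differentiable ℂ Φ) {n : WithTop ℕ∞} :
    ContDiff ℝ n (fun q : ℝ × ℝ =>
      -((Φ ((q.1 : ℂ) + (q.2 : ℂ) * I)).re ^ 2 + (Φ ((q.1 : ℂ) + (q.2 : ℂ) * I)).im ^ 2) / 2 +
        q.2 * (-(Φ ((q.1 : ℂ) + (q.2 : ℂ) * I)).im)) := by
  have hre := potentialFlow_contDiff_re hΦ (n := n)
  have him := potentialFlow_contDiff_im hΦ (n := n)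
  exact (((hre.pow 2).add (him.pow 2)).neg.div_const 2).add (contDiff_snd.mul him.neg)

/-- Horizontal `L`-periodicity of the argument: `Φ((x + L) + iy) = Φ(x + iy)`. [folklore] -/
theorem potentialFlow_periodic_arg {L : ℝ} (hper : ∀ z : ℂ, Φ (z + L) = Φ z) (x y : ℝ) :
    Φ (((x + L : ℝ) : ℂ) + (y : ℂ) * I) = Φ ((x : ℂ) + (y : ℂ) * I) := by
  have : ((x + L : ℝ) : ℂ) + (y : ℂ) * I = ((x : ℂ) + (y : ℂ) * I) + (L : ℂ) := by
    push_cast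
    ring
  rw [this, hper]

/-- Real parts of a convergent complex-valued function converge. [folklore] -/
theorem potentialFlow_tendsto_re {l : Filter ℝ} {g : ℝ → ℂ} {c : ℂ} (h : Tendsto g l (𝓝 c)) :
    Tendsto (fun y => (g y).re) l (𝓝 c.re) :=
  (continuous_re.tendsto c).comp h

/-- Negated imaginary parts of a convergent complex-valued function converge. [folklore] -/
theorem potentialFlow_tendsto_neg_im {l : Filter ℝ} {g : ℝ → ℂ} {c : ℂ}
    (h : Tendsto g l (𝓝 c)) : Tendsto (fun y => -(g y).im) l (𝓝 (-c.im)) :=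
  ((continuous_im.tendsto c).comp h).neg

/-! ### The stub -/

/-- **Stub `stub_potentialFlow`.** An ENTIRE `L`-periodic complex velocity `Φ = u - iv` with the
pointwise far field `Φ(x + iy) → ±1/2` (`y → ±∞`) gives a steady member of the stretched class for
every viscosity: `u = Re Φ`, `v = -Im Φ` are harmonic conjugates (`Δu = Δv = 0`,
`∂ₓu + ∂_yv = 0`, `∂_yu = ∂ₓv`), and `p = -(u² + v²)/2 + y v` balances both momentum equations
identically (Bernoulli); also the slice derivatives `∂ₓu = Re Φ'`, `∂ₓv = -Im Φ'`. [folklore] -/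
theorem stub_potentialFlow (Φ : ℂ → ℂ) (hΦ : Differentiable ℂ Φ) (ν L : ℝ)
    (hper : ∀ z : ℂ, Φ (z + L) = Φ z)
    (htop : ∀ x : ℝ, Tendsto (fun y : ℝ => Φ ((x : ℂ) + (y : ℂ) * I)) atTop (𝓝 (1 / 2)))
    (hbot : ∀ x : ℝ, Tendsto (fun y : ℝ => Φ ((x : ℂ) + (y : ℂ) * I)) atBot (𝓝 (-(1 / 2)))) :
    IsSteadyStretchedLayerNSSolution ν 1 1 L
        (fun x y => (Φ ((x : ℂ) + (y : ℂ) * I)).re)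
        (fun x y => -(Φ ((x : ℂ) + (y : ℂ) * I)).im)
        (fun x y => -((Φ ((x : ℂ) + (y : ℂ) * I)).re ^ 2 + (Φ ((x : ℂ) + (y : ℂ) * I)).im ^ 2) / 2 +
          y * (-(Φ ((x : ℂ) + (y : ℂ) * I)).im)) ∧
      (∀ x y : ℝ, dX (fun x y => (Φ ((x : ℂ) + (y : ℂ) * I)).re) x y =
        (deriv Φ ((x : ℂ) + (y : ℂ) * I)).re) ∧
      (∀ x y : ℝ, dX (fun x y => -(Φ ((x : ℂ) + (y : ℂ) * I)).im) x y =
        -(deriv Φ ((x : ℂ) + (y : ℂ) * I)).im) := by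
  refine ⟨?_, fun x y => potentialFlow_dX_u hΦ x y, fun x y => potentialFlow_dX_v hΦ x y⟩
  exact
    { contDiff_u := potentialFlow_contDiff_re hΦ
      contDiff_v := (potentialFlow_contDiff_im hΦ).neg
      contDiff_p := potentialFlow_contDiff_p hΦ
      momentum_x := fun x y => by
        rw [potentialFlow_dX_u hΦ, potentialFlow_dY_u hΦ, potentialFlow_dX_p hΦ,
          potentialFlow_lap_u hΦ]
        ring
      momentum_y := fun x y => by
        rw [potentialFlow_dX_v hΦ, potentialFlow_dY_v hΦ, potentialFlow_dY_p hΦ,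
          potentialFlow_lap_v hΦ]
        ring
      divFree := fun x y => by
        rw [potentialFlow_dX_u hΦ, potentialFlow_dY_v hΦ]
        ring
      periodic_u := fun x y => by
        simp only [potentialFlow_periodic_arg hper]
      periodic_v := fun x y => by
        simp only [potentialFlow_periodic_arg hper]
      periodic_p := fun x y => by
        simp only [potentialFlow_periodic_arg hper]
      tendsto_u_atTop := fun x => by simpa using potentialFlow_tendsto_re (htop x)
      tendsto_u_atBot := fun x => by simpa using potentialFlow_tendsto_re (hbot x)
      tendsto_v_atTop := fun x => by simpa using potentialFlow_tendsto_neg_im (htop x)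
      tendsto_v_atBot := fun x => by simpa using potentialFlow_tendsto_neg_im (hbot x) }

end PotentialFlow
end MarginalStabilityChainStretchedVortexRows
end Summit.AnomalousDissipation.AnomalousDissipation.Theorems
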